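import Literature.AlgebraicGeometry.DuqueFrancoVillaflor2025.SplitSurfaceFakeLinearCycles
import Literature.AlgebraicGeometry.MovasatiVillaflor2018.LinearCyclePeriods
import HarnessLib

/-!
# Fake linear cycles on `X = {F₀(x₀,x₁) + F₁(x₂,x₃) + ⋯ + F_{n/2}(x_n,x_{n+1}) = 0}` for EVERY even `n`
# (Duque Franco–Villaflor 2025, Thm. 1.5 of arXiv v1–v3 = Thm. 1.1 of arXiv v4, via the iterated join:
# Thm. 1.1 (v4: Thm. 1.2), Cor. 6.1, Thm. 7.1) — algebraic core

Certified instances and evidence bearing on the general Hodge conjecture; no claim.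

J. Duque Franco, R. Villaflor Loyola, *Periods of join algebraic cycles*, Ann. Sc. Norm. Super. Pisa (2025)
= arXiv:2312.17222 [DuqueFrancoVillaflor2025Join]. The existence theorem for fake linear cycles — **Theorem 1.5
of arXiv v1–v3** (the held text `paper:arxiv-2312.17222`, p0004–p0005; LaTeX label `thm3`), verbatim: "For any
degree `d` and even dimension `n`, there are infinitely many smooth degree `d` hypersurfaces `X` of dimension `n`
in `ℙ^{n+1}` containing infinitely many `n/2`-dimensional fake linear cycles in `ℙ(H^{n/2,n/2}(X,ℚ)_prim)`";
renumbered **Theorem 1.1 in arXiv v4** (12 Sep 2025, the refereed revision; there with the extra hypothesis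
"such that `d ≥ 2 + 4/n`" and "fake linear cycles" for "`n/2`-dimensional fake linear cycles"). Its PROOF (§7, held text
p. 19, unchanged in v4): "Pick any degree `d` homogeneous polynomials `F_0, …, F_{n/2} ∈ ℚ[x,y]_d` such that each
`F_i` has only simple rational roots. Define `X := {F_0(x_0,x_1) + F_1(x_2,x_3) + ⋯ + F_{n/2}(x_n,x_{n+1}) = 0}
⊆ ℙ^{n+1}`. For each `i = 0, …, n/2` consider `X_i := {F_i(x_{2i},x_{2i+1}) = 0} ⊆ ℙ¹` and take any fake linear
cycle `δ_i ∈ H⁰(X_i,ℚ)_prim`. Then by (corHFjoin) `δ := J(δ_0, …, δ_{n/2}) ∈ H^{n/2,n/2}(X,ℚ)_prim` is a fake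
linear cycle." Ingredients in print (numbers of v1–v3, as everywhere in the tree; v4 numbers in brackets):
**Thm. 1.1 [v4: 1.2]** (`P_{J(Z₁,Z₂)} = P_{Z₁}·P_{Z₂}`, `R^{f+g,[J(Z₁,Z₂)]} = R^{f,[Z₁]} ⊗ R^{g,[Z₂]}`; tree
`IsArtinianGorenstein.colon_join`), **Cor. 6.1** (`HF_{[J(Z₁,Z₂)]} = HF_{[Z₁]} * HF_{[Z₂]}`; tree
`IsArtinianGorenstein.hilbert_join`), **Ex. 6.1** (`HF_{[ℙ^{n/2}]} = φ^{*(n/2+1)}`), **Def. 7.1** (fake version of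
`[Z]`: same Hilbert function `HF_λ = HF_{[Z]}` and `λ_prim ∉ ℚ·[Z]_prim`), **Rem. 7.1** (eq. (eqAGfakelcFermat)
`J^{F,λ} = ⟨x_0 − c_0x_1, x_2 − c_1x_3, …, x_n − c_{n/2}x_{n+1}, x_0^{d−1}, …, x_{n+1}^{d−1}⟩` and
"`R^{F,λ} = ⊗_{j=1}^{n/2+1} R^{F_j,λ_j}`"), **Thm. 7.1** (the `0`-dimensional fake linear cycles on
`{∏(x₀ − r_ix₁) = 0} ⊂ ℙ¹`, tree `ZeroDimensionalFakeLinearCycles.lean`). The tree file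
`SplitSurfaceFakeLinearCycles.lean` is the case `n = 2` (one binary join); this file ITERATES the join over
`m = n/2 + 1` blocks, for every `m`.

## What this file PROVES (0 facts, 0 sorry), over any field `K`

**The `m`-fold join** (§"BlockJoin", any finite set `β` of variables per block, blocks indexed by `Fin m`, total
variables `Fin m × β`): for ideals `I_j ⊆ K[x_b : b ∈ β]`, `blockJoin I = Σ_j I_j·S ⊆ S = K[x_{(j,b)}]`
(`I_j` put in the `j`-th block). By induction on `m` through the tree's binary join along the relabeling
`blockEquiv : (Fin m × β) ⊔ β ≃ Fin (m+1) × β` (`blockJoin_succ`), with Artinian-Gorenstein-ness, colon ideals and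
Hilbert functions transported along variable bijections (`IsArtinianGorenstein.map_rename_equiv`,
`colon_map_rename_equiv`, tree `hilbert_map_rename_equiv`):
* `isArtinianGorenstein_blockJoin`: `I_j` Artinian Gorenstein of socle `s_j` ⟹ `Σ_j I_jS` Artinian Gorenstein of
  socle `Σ_j s_j` ("`R^{f+g} = R^f ⊗ R^g`", iterated);
* `colon_blockJoin` (**Thm. 1.1 iterated**): `(Σ_j I_jS : ∏_j P_j(x_{(j,·)})) = Σ_j (I_j : P_j)S` for Artinian
  Gorenstein `I_j` and ANY forms `P_j` ("`R^{F,δ} = ⊗_j R^{F_j,δ_j}`" for `δ = J(δ_0,…,δ_{m−1})`, `P_δ = ∏ P_{δ_j}`);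
* `hilbert_blockJoin` / `hilbert_blockJoin_const` (**Cor. 6.1 iterated**): `HF_{Σ I_jS} = HF_{I_0} * ⋯ * HF_{I_{m−1}}`
  (`blockConv`), `= h^{*m}` (tree `convPow`) when all `HF_{I_j} = h`.

**The hypersurface** `X = {F = 0}`, `F = blockSum F_• = Σ_{j<m} F_j(x_{(j,0)}, x_{(j,1)})` for binary forms
`F_j ∈ K[x,y]_d` (the printed `x_{2j+i}` is `x_{(j,i)}`; §"Printed" relabels to `x_0, …, x_{2m−1}` via
`pairIndexEquiv`, `splitSumForm`, with the tree's `jacobianIdeal`):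
* `blockSumJacobian_eq_blockJoin`: `J^F = Σ_j J^{F_j}S` (the partials of a sum of forms in disjoint variables,
  `pderiv_blockSum`); `isArtinianGorenstein_blockSumJacobian`: `J^F` is Artinian Gorenstein of socle `m·2(d−2)
  = (d−2)(n+2)` when the `J^{F_j}` are (socle `2(d−2)`), i.e. `X` is smooth when the `X_j ⊂ ℙ¹` are — for the
  printed `F_j = ∏_i(x − r_{j,i}y)` with simple roots and `d ≠ 0` in `K`: `isArtinianGorenstein_blockSumJacobian_splitForm`;
* `joinPointIdeal d c = Σ_j ⟨x_{(j,0)} − c_jx_{(j,1)}, x_{(j,1)}^{d−1}⟩S`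
  `= ⟨x_{(j,0)} − c_jx_{(j,1)}, x_{(j,0)}^{d−1}, x_{(j,1)}^{d−1} : j < m⟩` (`joinPointIdeal_eq_span`) — eq.
  (eqAGfakelcFermat) — is Artinian Gorenstein of socle `m(d−2) = (d−2)(n/2+1)` with Hilbert function
  `φ^{*m} = ciHilbert [(d−1)^m]` for EVERY `c` (`hilbert_joinPointIdeal`; Ex. 6.1 / Rem. 7.1 "`HF_λ = HF_{[ℙ^{n/2}]}`");
* **`blockSumJacobian_colon_eq_joinPointIdeal`** (Thm. 1.1 iterated + Thm. 7.1): for `d ≥ 2`, points `c_j` at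
  which the partials of `F_j` do not both vanish and forms `P_j ≠ 0` of degree `d − 2` with
  `P_j·(x − c_jy) ∈ J^{F_j}` (the classes `δ_j` with the Hilbert function of a point — genuine points or DFV's fake
  ones), `(J^F : ∏_j P_j(x_{(j,·)})) = joinPointIdeal d c`; hence its Hilbert function is `ciHilbert [(d−1)^m]`,
  that of a linear cycle (`hilbert_blockSumJacobian_colon`);
* **`ne_smul_of_prod`** (Def. 7.1, fakeness): for `d ≥ 3` the products attached to point tuples `c ≠ c'` are never
  proportional (`joinPointIdeal_injective`: project onto one block, tree `pointIdeal_injective`) — so over an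
  infinite `K` each such `X` carries infinitely many pairwise non-proportional classes of linear-cycle type;
* **`splitHypersurface_fake_linear_cycle`** (the theorem, every `m`, i.e. EVERY even `n = 2m − 2`, every
  `d ≥ 3` with `d ≠ 0` in `K`) on the printed `X = {Σ_j ∏_i (x_{(j,0)} − r_{j,i}x_{(j,1)}) = 0}` (`r_j` injective):
  for a tuple `c` with some `c_j` not a root of `F_j` (that `δ_j` is fake, Thm. 7.1) and `P_j` as above (they
  exist: `exists_blockPolynomials_splitForm`, from the tree's `exists_dfvPolynomial_splitForm` /
  `exists_pointPolynomial_splitForm`), and for EVERY genuine linear cycle `{x_{(j,0)} = r_{j,i_j}x_{(j,1)}} ⊂ X`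
  with polynomials `Q_j`: (i) `(J^F : ∏P_j)` is the printed ideal (eqAGfakelcFermat); (ii) `(J^F : ∏P_j)` and
  `(J^F : ∏Q_j)` have the same Hilbert function; (iii) `∏P_j ∉ K·∏Q_j`. `splitHypersurface_fake_linear_cycle'`:
  the same in the coordinates `x_0, …, x_{2m−1}` of `ℙ^{2m−1}` with the tree's `jacobianIdeal (splitSumForm F)`;
  `infinite_fake_colon_ideals`: over an infinite `K` the Gorenstein ideals `(J^F : ∏P_j)` of these fake classes
  form an infinite set ("… containing infinitely many fake linear cycles").

Not formalised (cited): the residue/period dictionary `δ ↦ P_δ`, `(J^F : P_δ) = J^{F,δ}`, `P_{J(Z₁,Z₂)} = P_{Z₁}P_{Z₂}`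
as a statement about periods (Thm. 1.1 first part / Thm. 1.2), rationality of `δ` (in print `K = ℚ`, all `P_j`,
`Q_j ∈ ℚ[x,y]`), and Thm. 7.2 (non-reducedness/singularity of `V_δ` via the quadratic fundamental form).

## References

* [DuqueFrancoVillaflor2025Join] Thm. 1.5 (arXiv v1–v3; = Thm. 1.1 of arXiv v4) with its proof (§7, p. 19),
  Thm. 1.1 [v4: 1.2], Def. 2.1–2.2, Rem. 2.1, Cor. 6.1, Ex. 6.1, Def. 7.1, Rem. 7.1 eq. (eqAGfakelcFermat),
  Thm. 7.1, Thm. 7.2 (same `X`).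
* [IarrobinoKanev1999] Lemma 2.12 / 2.14 (Macaulay's inverse systems; used for the transport of Artinian
  Gorenstein ideals along a relabeling).
-/

noncomputable section

open MvPolynomial Module
open Literature.RingTheory.MvPolynomial Literature.AlgebraicGeometry.Kloosterman2023
open Literature.AlgebraicGeometry.Kloosterman2025
open Literature.AlgebraicGeometry.HodgeTheory
open Literature.AlgebraicGeometry.Motives.UniversalHypersurface
open Literature.AlgebraicGeometry.MovasatiVillaflor2018

attribute [local instance] MvPolynomial.gradedAlgebra

namespace Literature.AlgebraicGeometry.DuqueFrancoVillaflor2025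

universe u

variable {K : Type u} [Field K]

/-! ## Transport along a relabeling of the variables -/

section Transport

variable {σ σ' : Type*}

/-- For a bijection `θ` of variable sets, `I.map (rename θ) = I.comap (rename θ⁻¹)`. [folklore] -/
private theorem map_rename_eq_comap_rename_symm_of_equiv (θ : σ ≃ σ') (I : Ideal (MvPolynomial σ K)) :
    I.map (rename θ : MvPolynomial σ K →ₐ[K] MvPolynomial σ' K) =
      I.comap (rename θ.symm : MvPolynomial σ' K →ₐ[K] MvPolynomial σ K) := by
  apply le_antisymm
  · refine Ideal.map_le_iff_le_comap.mpr fun g hg => ?_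
    rw [Ideal.mem_comap, Ideal.mem_comap, rename_rename, Equiv.symm_comp_self, rename_id, AlgHom.id_apply]
    exact hg
  · intro q hq
    rw [Ideal.mem_comap] at hq
    have h : rename θ (rename θ.symm q) = q := by
      rw [rename_rename, Equiv.self_comp_symm, rename_id, AlgHom.id_apply]
    rw [← h]
    exact Ideal.mem_map_of_mem _ hq

/-- Membership in the relabelled ideal: `q ∈ I.map (rename θ) ↔ rename θ⁻¹ q ∈ I`. [folklore] -/
private theorem mem_map_rename_equiv_iff (θ : σ ≃ σ') (I : Ideal (MvPolynomial σ K)) (q : MvPolynomial σ' K) :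
    q ∈ I.map (rename θ : MvPolynomial σ K →ₐ[K] MvPolynomial σ' K) ↔ rename θ.symm q ∈ I := by
  rw [map_rename_eq_comap_rename_symm_of_equiv, Ideal.mem_comap]

/-- **Colon ideals commute with a relabeling of the variables**:
`(I.map (rename θ) : rename θ P) = (I : P).map (rename θ)` (Villaflor: "After relabeling the variables we can
assume …" — nothing about `(J^F : P)` depends on the names of the variables). [cite: Villaflorloyola2021, Proposition 4.1] -/
theorem colon_map_rename_equiv (θ : σ ≃ σ') (I : Ideal (MvPolynomial σ K)) (P : MvPolynomial σ K) :
    (I.map (rename θ : MvPolynomial σ K →ₐ[K] MvPolynomial σ' K)).colon {rename θ P} =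
      (I.colon {P}).map (rename θ : MvPolynomial σ K →ₐ[K] MvPolynomial σ' K) := by
  ext q
  rw [Submodule.mem_colon_singleton, mem_map_rename_equiv_iff, mem_map_rename_equiv_iff,
    Submodule.mem_colon_singleton, smul_eq_mul, smul_eq_mul, map_mul, rename_rename, Equiv.symm_comp_self,
    rename_id, AlgHom.id_apply]

/-- **Artinian Gorenstein ideals are preserved by a relabeling of the variables** (same socle degree):
`I = Ann(ℓ)` gives `I.map (rename θ) = Ann(ℓ ∘ rename θ⁻¹)` (Macaulay's correspondence, tree
`isArtinianGorenstein_iff_exists_annIdeal`). [cite: DuqueFrancoVillaflor2025Join, Definition 2.1]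
[cite: IarrobinoKanev1999, Lemma 2.12, Lemma 2.14] -/
theorem IsArtinianGorenstein.map_rename_equiv [Finite σ] [Finite σ'] (θ : σ ≃ σ')
    {I : Ideal (MvPolynomial σ K)} {s : ℕ} (h : IsArtinianGorenstein I s) :
    IsArtinianGorenstein (I.map (rename θ : MvPolynomial σ K →ₐ[K] MvPolynomial σ' K)) s := by
  obtain ⟨ℓ, hℓ, hne, rfl⟩ := h.exists_eq_annIdeal
  let φ : MvPolynomial σ' K →ₐ[K] MvPolynomial σ K := rename θ.symm
  have hφ : Function.Surjective φ := fun p =>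
    ⟨rename θ p, by rw [show φ = rename θ.symm from rfl, rename_rename, Equiv.symm_comp_self, rename_id,
      AlgHom.id_apply]⟩
  have hmap : (annIdeal ℓ).map (rename θ : MvPolynomial σ K →ₐ[K] MvPolynomial σ' K) =
      annIdeal (ℓ ∘ₗ φ.toLinearMap) := by
    rw [annIdeal_comp_of_surjective φ hφ, map_rename_eq_comap_rename_symm_of_equiv]
  rw [hmap]
  refine isArtinianGorenstein_annIdeal (fun p => ?_) fun h0 => hne ?_
  · simp only [LinearMap.coe_comp, Function.comp_apply, AlgHom.toLinearMap_apply]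
    rw [show φ (homogeneousComponent s p) = homogeneousComponent s (φ p) from
      rename_homogeneousComponent s p, hℓ]
  · refine LinearMap.ext fun p => ?_
    obtain ⟨q, rfl⟩ := hφ p
    have := LinearMap.congr_fun h0 q
    simpa only [LinearMap.coe_comp, Function.comp_apply, AlgHom.toLinearMap_apply, LinearMap.zero_apply]
      using this

end Transport

/-! ## Adding one block of variables: `(Fin m × β) ⊔ β ≃ Fin (m+1) × β` -/

section BlockEquiv

variable (m : ℕ) (β : Type*)

/-- The relabeling `(j, b) ↦ (j, b)` (`j < m`), `b ↦ (m, b)`: the variables of `m + 1` blocks are those of the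
first `m` blocks together with one more block. [folklore] -/
def blockEquiv : (Fin m × β) ⊕ β ≃ Fin (m + 1) × β where
  toFun := Sum.elim (fun jb => (Fin.castSucc jb.1, jb.2)) fun b => (Fin.last m, b)
  invFun jb := if h : (jb.1 : ℕ) < m then Sum.inl (⟨jb.1, h⟩, jb.2) else Sum.inr jb.2
  left_inv := by
    rintro (⟨j, b⟩ | b)
    · simp
    · simp
  right_inv := by
    rintro ⟨j, b⟩
    by_cases h : (j : ℕ) < m
    · simp only [h, dite_true, Sum.elim_inl, Prod.mk.injEq, and_true]
      ext; rfl
    · simp only [h, dite_false, Sum.elim_inr, Prod.mk.injEq, and_true]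
      ext
      have := j.2
      simp only [Fin.val_last]
      omega

variable {m β}

/-- `blockEquiv` on the first `m` blocks: `(j, b) ↦ (j, b)`. [folklore] -/
@[simp] private theorem blockEquiv_inl (j : Fin m) (b : β) : blockEquiv m β (Sum.inl (j, b)) = (Fin.castSucc j, b) := rfl

/-- `blockEquiv` on the new block: `b ↦ (m, b)`. [folklore] -/
@[simp] private theorem blockEquiv_inr (b : β) : blockEquiv m β (Sum.inr b) = (Fin.last m, b) := rfl

/-- `rename (blockEquiv) ∘ rename inl ∘ rename (j, ·) = rename (castSucc j, ·)`. [folklore] -/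
private theorem rename_blockEquiv_comp_inl_comp (j : Fin m) :
    (((rename (blockEquiv m β) : MvPolynomial ((Fin m × β) ⊕ β) K →ₐ[K] MvPolynomial (Fin (m + 1) × β) K).comp
        (rename (Sum.inl : Fin m × β → (Fin m × β) ⊕ β))).comp (rename (Prod.mk j))) =
      rename (Prod.mk (Fin.castSucc j)) := by
  refine MvPolynomial.algHom_ext fun b => ?_
  simp

/-- `rename (blockEquiv) ∘ rename inr = rename (last m, ·)`. [folklore] -/
private theorem rename_blockEquiv_comp_inr :
    ((rename (blockEquiv m β) : MvPolynomial ((Fin m × β) ⊕ β) K →ₐ[K] MvPolynomial (Fin (m + 1) × β) K).comp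
        (rename (Sum.inr : β → (Fin m × β) ⊕ β))) =
      rename (Prod.mk (Fin.last m)) := by
  refine MvPolynomial.algHom_ext fun b => ?_
  simp

/-- On elements: `rename blockEquiv (rename inl (rename (j,·) p)) = rename (castSucc j, ·) p`. [folklore] -/
private theorem rename_blockEquiv_rename_inl (j : Fin m) (p : MvPolynomial β K) :
    rename (blockEquiv m β) (rename (Sum.inl : Fin m × β → (Fin m × β) ⊕ β) (rename (Prod.mk j) p)) =
      rename (R := K) (Prod.mk (Fin.castSucc j)) p := by
  have := congrArg (fun f => f p) (rename_blockEquiv_comp_inl_comp (K := K) (β := β) j)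
  simpa using this

/-- On elements: `rename blockEquiv (rename inr p) = rename (last m, ·) p`. [folklore] -/
private theorem rename_blockEquiv_rename_inr (p : MvPolynomial β K) :
    rename (blockEquiv m β) (rename (Sum.inr : β → (Fin m × β) ⊕ β) p) =
      rename (R := K) (Prod.mk (Fin.last m)) p := by
  have := congrArg (fun f => f p) (rename_blockEquiv_comp_inr (K := K) (β := β) (m := m))
  simpa using this

end BlockEquiv

/-! ## The `m`-fold join of ideals in disjoint blocks of variables -/

section BlockJoin

variable {β : Type*}

/-- **The iterated join** `I₀·S + I₁·S + ⋯ + I_{m−1}·S ⊆ S = K[x_{(j,b)} : j < m, b ∈ β]` of ideals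
`I_j ⊆ K[x_b : b ∈ β]`, the `j`-th put in the `j`-th block of variables: the homogeneous ideal of the join
`J(Z₀, …, Z_{m−1})` ("`S(J(Z₁,Z₂)) = S(Z₁) ⊗ S(Z₂)`", iterated), and for Jacobian / Artinian Gorenstein ideals
the ideal with `S/(Σ_j I_j S) = ⊗_j K[x]/I_j` ("`R^{F,λ} = ⊗_{j=1}^{n/2+1} R^{F_j,λ_j}`", Rem. 7.1).
[cite: DuqueFrancoVillaflor2025Join, Theorem 1.1 and Remark 7.1] -/
def blockJoin {m : ℕ} (I : Fin m → Ideal (MvPolynomial β K)) : Ideal (MvPolynomial (Fin m × β) K) :=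
  ⨆ j, (I j).map (rename (Prod.mk j) : MvPolynomial β K →ₐ[K] MvPolynomial (Fin m × β) K)

/-- `⨆_{j ≤ m} f j = (⨆_{j < m} f (castSucc j)) ⊔ f (last m)`. [folklore] -/
private theorem iSup_fin_succ {α : Type*} [CompleteLattice α] {m : ℕ} (f : Fin (m + 1) → α) :
    ⨆ j, f j = (⨆ j : Fin m, f (Fin.castSucc j)) ⊔ f (Fin.last m) := by
  apply le_antisymm
  · refine iSup_le fun j => ?_
    refine Fin.lastCases ?_ (fun j' => ?_) j
    · exact le_sup_right
    · exact le_sup_of_le_left (le_iSup (fun j : Fin m => f (Fin.castSucc j)) j')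
  · exact sup_le (iSup_le fun j' => le_iSup f _) (le_iSup f _)

/-- **Recursion of the iterated join**: the join over `m + 1` blocks is the (binary, tree) join of the join over
the first `m` blocks with the last block, relabelled along `blockEquiv`.
[cite: DuqueFrancoVillaflor2025Join, Theorem 1.1 and Remark 7.1] -/
theorem blockJoin_succ {m : ℕ} (I : Fin (m + 1) → Ideal (MvPolynomial β K)) :
    blockJoin I = ((blockJoin fun j : Fin m => I (Fin.castSucc j)).map (rename Sum.inl) ⊔
        (I (Fin.last m)).map (rename Sum.inr) : Ideal (MvPolynomial ((Fin m × β) ⊕ β) K)).map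
      (rename (blockEquiv m β) : MvPolynomial ((Fin m × β) ⊕ β) K →ₐ[K] MvPolynomial (Fin (m + 1) × β) K) := by
  rw [Ideal.map_sup, blockJoin, blockJoin, Ideal.map_iSup, Ideal.map_iSup, iSup_fin_succ]
  congr 1
  · refine iSup_congr fun j => ?_
    rw [Ideal.map_mapₐ, Ideal.map_mapₐ, rename_blockEquiv_comp_inl_comp]
  · rw [Ideal.map_mapₐ, rename_blockEquiv_comp_inr]

/-- The product `∏_j P_j(x_{(j,·)})` of one form per block, relabelled: recursion.
[cite: DuqueFrancoVillaflor2025Join, Theorem 1.1] -/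
theorem prod_rename_succ {m : ℕ} (P : Fin (m + 1) → MvPolynomial β K) :
    ∏ j, rename (R := K) (Prod.mk j) (P j) =
      rename (blockEquiv m β) (rename Sum.inl (∏ j : Fin m, rename (R := K) (Prod.mk j) (P (Fin.castSucc j))) *
        rename Sum.inr (P (Fin.last m))) := by
  rw [Fin.prod_univ_castSucc, map_mul, rename_blockEquiv_rename_inr, map_prod, map_prod]
  congr 1
  refine Finset.prod_congr rfl fun j _ => ?_
  exact (rename_blockEquiv_rename_inl j (P (Fin.castSucc j))).symm

variable [Finite β]

/-- No blocks: the zero ideal of `K[∅] = K` is Artinian Gorenstein of socle `0`. [folklore] -/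
private theorem isArtinianGorenstein_bot_of_isEmpty {γ : Type*} [Finite γ] [IsEmpty γ] :
    IsArtinianGorenstein (⊥ : Ideal (MvPolynomial γ K)) 0 := by
  refine ⟨Ideal.IsHomogeneous.bot _, fun e he => ?_, ?_, fun i hi g hg H => ?_⟩
  · rw [idealDegree_bot]
    refine le_antisymm bot_le fun p hp => ?_
    have hp' := (mem_homogeneousSubmodule _ _).mp hp
    rw [Submodule.mem_bot]
    by_contra hne
    have hC : p = C (coeff 0 p) := eq_C_of_isEmpty p
    have h0 : p.IsHomogeneous 0 := by rw [hC]; exact isHomogeneous_C _ _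
    exact absurd (IsHomogeneous.inj_right hp' h0 hne) (by omega)
  · rw [idealDegree_bot, finrank_bot, Nat.sub_zero]
    have h1 : homogeneousSubmodule γ K 0 = K ∙ (1 : MvPolynomial γ K) := by
      apply le_antisymm
      · intro p hp
        rw [Submodule.mem_span_singleton]
        refine ⟨coeff 0 p, ?_⟩
        rw [Algebra.smul_def, mul_one, algebraMap_eq]
        exact (eq_C_of_isEmpty p).symm
      · rw [Submodule.span_le, Set.singleton_subset_iff]
        exact (mem_homogeneousSubmodule _ _).mpr (isHomogeneous_one γ K)
    rw [h1, finrank_span_singleton one_ne_zero]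
  · have hi0 : i = 0 := by omega
    subst hi0
    have := H 1 (isHomogeneous_one γ K)
    rwa [mul_one] at this

/-- **The iterated join of Artinian Gorenstein ideals is Artinian Gorenstein, of socle the sum of the socles**
(`S/(Σ I_jS) = ⊗_j K[x]/I_j`; Thm. 1.1's "`R^{f+g} = R^f ⊗ R^g` is Artinian Gorenstein of socle `(d−2)(n+2)`",
iterated). [cite: DuqueFrancoVillaflor2025Join, Theorem 1.1 (proof) and Remark 7.1] -/
theorem isArtinianGorenstein_blockJoin {m : ℕ} {I : Fin m → Ideal (MvPolynomial β K)} {s : Fin m → ℕ}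
    (h : ∀ j, IsArtinianGorenstein (I j) (s j)) : IsArtinianGorenstein (blockJoin I) (∑ j, s j) := by
  induction m with
  | zero =>
    have hbot : blockJoin I = ⊥ := by
      rw [blockJoin]; exact iSup_of_empty _
    rw [hbot, Finset.univ_eq_empty, Finset.sum_empty]
    exact isArtinianGorenstein_bot_of_isEmpty
  | succ m ih =>
    rw [blockJoin_succ, Fin.sum_univ_castSucc]
    exact (isArtinianGorenstein_join (ih fun j => h (Fin.castSucc j)) (h (Fin.last m))).map_rename_equiv _

/-- **Theorem 1.1 for the iterated join**: for Artinian Gorenstein `I_j ⊆ K[x]` and ANY forms `P_j ∈ K[x]`,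
`((Σ_j I_jS) : ∏_j P_j(x_{(j,·)})) = Σ_j (I_j : P_j)S` — iterating
`(J^{f+g} : P_{Z₁}P_{Z₂}) = J^{f,[Z₁]}S + J^{g,[Z₂]}S`, i.e. `R^{F,δ} = ⊗_j R^{F_j,δ_j}` for
`δ = J(δ₀, …, δ_{n/2})`. [cite: DuqueFrancoVillaflor2025Join, Theorem 1.1 and Remark 7.1] -/
theorem colon_blockJoin {m : ℕ} {I : Fin m → Ideal (MvPolynomial β K)} {s : Fin m → ℕ}
    (h : ∀ j, IsArtinianGorenstein (I j) (s j)) (P : Fin m → MvPolynomial β K) :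
    (blockJoin I).colon {∏ j, rename (R := K) (Prod.mk j) (P j)} = blockJoin fun j => (I j).colon {P j} := by
  induction m with
  | zero =>
    have hbot : ∀ I' : Fin 0 → Ideal (MvPolynomial β K), blockJoin I' = ⊥ := fun I' => by
      rw [blockJoin]; exact iSup_of_empty _
    rw [hbot, hbot, Finset.univ_eq_empty, Finset.prod_empty]
    ext q
    rw [Submodule.mem_colon_singleton, smul_eq_mul, mul_one]
  | succ m ih =>
    rw [blockJoin_succ, prod_rename_succ, colon_map_rename_equiv,
      (isArtinianGorenstein_blockJoin fun j => h (Fin.castSucc j)).colon_join (h (Fin.last m)),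
      ih (fun j => h (Fin.castSucc j)), blockJoin_succ]

/-- The Hilbert function of an `m`-fold join, from the Hilbert functions `h j` of the blocks:
`δ₀` for no block, and `(h₀ * ⋯ * h_{m−1}) * h_m` recursively (convolution). [cite: DuqueFrancoVillaflor2025Join, Corollary 6.1] -/
def blockConv : (m : ℕ) → (Fin m → ℕ → ℕ) → ℕ → ℕ
  | 0, _ => delta
  | m + 1, h => conv (blockConv m fun j => h (Fin.castSucc j)) (h (Fin.last m))

/-- With equal blocks the iterated convolution is the convolution power `HF^{*m}` (tree `convPow`).
[cite: DuqueFrancoVillaflor2025Join, Example 6.1] -/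
theorem blockConv_const (m : ℕ) (h : ℕ → ℕ) : blockConv m (fun _ => h) = convPow h m := by
  induction m with
  | zero => rfl
  | succ m ih =>
    simp only [blockConv, convPow_succ]
    rw [ih]

/-- The Hilbert function of `K[∅] = K`: `δ₀`. [folklore] -/
private theorem hilbert_bot_of_isEmpty {γ : Type*} [Finite γ] [IsEmpty γ] (k : ℕ) :
    finrank K (homogeneousSubmodule γ K k) - finrank K (idealDegree (⊥ : Ideal (MvPolynomial γ K)) k) =
      delta k := by
  have h := isArtinianGorenstein_bot_of_isEmpty (K := K) (γ := γ)
  by_cases hk : k = 0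
  · subst hk
    rw [h.hilbert_top, delta, if_pos rfl]
  · rw [h.idealDegree_eq_of_lt (Nat.pos_of_ne_zero hk), Nat.sub_self, delta, if_neg hk]

/-- **Corollary 6.1 for the iterated join**: `HF_{Σ_j I_jS} = HF_{I₀} * HF_{I₁} * ⋯ * HF_{I_{m−1}}`
(convolution) for Artinian Gorenstein blocks — "`HF_{[J(Z₁,Z₂)]} = HF_{[Z₁]} * HF_{[Z₂]}`", iterated.
[cite: DuqueFrancoVillaflor2025Join, Corollary 6.1] -/
theorem hilbert_blockJoin {m : ℕ} {I : Fin m → Ideal (MvPolynomial β K)}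
    {s : Fin m → ℕ} (h : ∀ j, IsArtinianGorenstein (I j) (s j)) {hf : Fin m → ℕ → ℕ}
    (hhf : ∀ j t, finrank K (homogeneousSubmodule β K t) - finrank K (idealDegree (I j) t) = hf j t) (k : ℕ) :
    finrank K (homogeneousSubmodule (Fin m × β) K k) - finrank K (idealDegree (blockJoin I) k) =
      blockConv m hf k := by
  induction m generalizing k with
  | zero =>
    have hbot : blockJoin I = ⊥ := by
      rw [blockJoin]; exact iSup_of_empty _
    rw [hbot, blockConv]
    exact hilbert_bot_of_isEmpty k
  | succ m ih =>
    rw [blockJoin_succ, hilbert_map_rename_equiv,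
      (isArtinianGorenstein_blockJoin fun j => h (Fin.castSucc j)).hilbert_join (h (Fin.last m)), blockConv]
    congr 1
    · funext p
      exact ih (fun j => h (Fin.castSucc j)) (fun j t => hhf (Fin.castSucc j) t) p
    · funext q
      exact hhf (Fin.last m) q

/-- … with equal Hilbert functions `HF_{I_j} = h` on all blocks: `HF_{Σ I_jS} = h^{*m}`
("`HF_{[ℙ^{n/2}]} = φ^{*(n/2+1)}`", Ex. 6.1). [cite: DuqueFrancoVillaflor2025Join, Corollary 6.1 and Example 6.1] -/
theorem hilbert_blockJoin_const {m : ℕ} {I : Fin m → Ideal (MvPolynomial β K)}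
    {s : Fin m → ℕ} (h : ∀ j, IsArtinianGorenstein (I j) (s j)) {hf : ℕ → ℕ}
    (hhf : ∀ j t, finrank K (homogeneousSubmodule β K t) - finrank K (idealDegree (I j) t) = hf t) (k : ℕ) :
    finrank K (homogeneousSubmodule (Fin m × β) K k) - finrank K (idealDegree (blockJoin I) k) =
      convPow hf m k := by
  rw [hilbert_blockJoin h (hf := fun _ => hf) hhf k, blockConv_const]

end BlockJoin

/-! ## The hypersurface `X = {F₀(x₀,x₁) + F₁(x₂,x₃) + ⋯ + F_{m−1}(x_{2m−2},x_{2m−1}) = 0}` and its Jacobian ideal -/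

section BlockSum

variable {m d : ℕ}

/-- **The form `F₀(x₀,x₁) + F₁(x₂,x₃) + ⋯ + F_{m−1}(x_{2m−2},x_{2m−1})`** (`m = n/2 + 1` binary forms in disjoint
pairs of variables; the variable `x_{2j+i}` is written `x_{(j,i)}`, `j < m`, `i < 2`): DFV's
`X := {F_0(x_0,x_1) + F_1(x_2,x_3) + ⋯ + F_{n/2}(x_n,x_{n+1}) = 0} ⊆ ℙ^{n+1}`.
[cite: DuqueFrancoVillaflor2025Join, Theorem 1.5 (proof, p. 19; = Theorem 1.1 of arXiv v4) and Theorem 7.2] -/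
def blockSum (F : Fin m → MvPolynomial (Fin 2) K) : MvPolynomial (Fin m × Fin 2) K :=
  ∑ j, rename (Prod.mk j) (F j)

/-- Its Jacobian ideal `J^F = ⟨∂F/∂x_{(j,i)} : j < m, i < 2⟩`. [cite: DuqueFrancoVillaflor2025Join, Definition 2.2] -/
def blockSumJacobian (F : Fin m → MvPolynomial (Fin 2) K) : Ideal (MvPolynomial (Fin m × Fin 2) K) :=
  Ideal.span (Set.range fun z : Fin m × Fin 2 => pderiv z (blockSum F))

/-- `Σ_j F_j(x_{(j,·)})` is a form of degree `d` when the `F_j ∈ K[x,y]_d` are ("degree `d` homogeneous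
polynomials `F_0, …, F_{n/2}`"). [cite: DuqueFrancoVillaflor2025Join, Theorem 1.5 (proof; = Theorem 1.1 of arXiv v4)] -/
theorem isHomogeneous_blockSum {F : Fin m → MvPolynomial (Fin 2) K} (hF : ∀ j, (F j).IsHomogeneous d) :
    (blockSum F).IsHomogeneous d :=
  IsHomogeneous.sum _ _ _ fun j _ => (hF j).rename_isHomogeneous

/-- **The partials of a sum of forms in disjoint variables**: `∂/∂x_{(j,i)} (Σ_j F_j) = (∂F_j/∂x_i)(x_{(j,·)})`.
[cite: DuqueFrancoVillaflor2025Join, Theorem 1.1 (proof: "`R^{f+g} = R^f ⊗ R^g`")] -/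
theorem pderiv_blockSum (F : Fin m → MvPolynomial (Fin 2) K) (j : Fin m) (i : Fin 2) :
    pderiv (j, i) (blockSum F) = rename (Prod.mk j) (pderiv i (F j)) := by
  classical
  rw [blockSum, map_sum, Finset.sum_eq_single j]
  · exact pderiv_rename (Prod.mk_right_injective j) i (F j)
  · intro j' _ hj'
    refine pderiv_eq_zero_of_notMem_vars fun hmem => hj' ?_
    obtain ⟨i', -, hi'⟩ := Finset.mem_image.mp (vars_rename (Prod.mk j') (F j') hmem)
    exact congrArg Prod.fst hi'
  · intro h
    exact absurd (Finset.mem_univ j) h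

/-- **`J^{F₀ ⊕ ⋯ ⊕ F_{m−1}} = Σ_j J^{F_j}·S`**: the Jacobian ideal of the sum is the iterated join of the Jacobian
ideals of the blocks (`J^{f+g} = J^f S + J^g S`, iterated). [cite: DuqueFrancoVillaflor2025Join, Theorem 1.1 (proof) and Remark 7.1] -/
theorem blockSumJacobian_eq_blockJoin (F : Fin m → MvPolynomial (Fin 2) K) :
    blockSumJacobian F = blockJoin fun j => jacobianIdeal (F j) := by
  rw [blockSumJacobian, blockJoin]
  have hrange : (Set.range fun z : Fin m × Fin 2 => pderiv z (blockSum F)) =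
      ⋃ j, (rename (Prod.mk j) : MvPolynomial (Fin 2) K →ₐ[K] MvPolynomial (Fin m × Fin 2) K) ''
        Set.range (fun i : Fin 2 => pderiv i (F j)) := by
    ext g
    simp only [Set.mem_range, Set.mem_iUnion, Set.mem_image, Prod.exists, pderiv_blockSum,
      exists_exists_eq_and]
  rw [hrange, Ideal.span_iUnion]
  refine iSup_congr fun j => ?_
  rw [jacobianIdeal, Ideal.map_span]

/-- **`X` is smooth when the `X_j = {F_j = 0} ⊂ ℙ¹` are**: if every `J^{F_j}` is Artinian Gorenstein of socle
`2(d−2)` then `J^F` is Artinian Gorenstein of socle `m·2(d−2) = (n+2)(d−2)` (`m = n/2+1`).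
[cite: DuqueFrancoVillaflor2025Join, Theorem 1.1 (proof) and Definition 2.2] -/
theorem isArtinianGorenstein_blockSumJacobian {F : Fin m → MvPolynomial (Fin 2) K}
    (hJ : ∀ j, IsArtinianGorenstein (jacobianIdeal (F j)) (2 * (d - 2))) :
    IsArtinianGorenstein (blockSumJacobian F) (m * (2 * (d - 2))) := by
  rw [blockSumJacobian_eq_blockJoin]
  have h := isArtinianGorenstein_blockJoin hJ
  rwa [Finset.sum_const, Finset.card_univ, Fintype.card_fin, smul_eq_mul] at h

/-! ## The Gorenstein ideal `⟨x_{(j,0)} − c_j x_{(j,1)}, x_{(j,i)}^{d−1}⟩` of a (fake or genuine) linear cycle -/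

/-- **`Σ_j ⟨x_{(j,0)} − c_jx_{(j,1)}, x_{(j,1)}^{d−1}⟩·S`**, the iterated join of `m` point ideals: the Gorenstein
ideal `J^{F,λ} = ⟨x_0 − c_0x_1, x_2 − c_1x_3, …, x_n − c_{n/2}x_{n+1}, x_0^{d−1}, …, x_{n+1}^{d−1}⟩` of
eq. (eqAGfakelcFermat) — of the linear cycle `J(p⁰,…,p^{n/2}) = {x_{2j} = c_jx_{2j+1}}` when the `c_j` are roots,
of its fake versions otherwise. [cite: DuqueFrancoVillaflor2025Join, Remark 7.1, eq. (eqAGfakelcFermat)] -/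
def joinPointIdeal (d : ℕ) (c : Fin m → K) : Ideal (MvPolynomial (Fin m × Fin 2) K) :=
  blockJoin fun j => pointIdeal d (c j)

/-- The explicit generators: `⟨x_{(j,0)} − c_jx_{(j,1)}, x_{(j,0)}^{d−1}, x_{(j,1)}^{d−1} : j < m⟩`.
[cite: DuqueFrancoVillaflor2025Join, Remark 7.1, eq. (eqAGfakelcFermat)] -/
theorem joinPointIdeal_eq_span (d : ℕ) (c : Fin m → K) :
    joinPointIdeal d c = Ideal.span (⋃ j : Fin m,
      {(X (j, 0) : MvPolynomial (Fin m × Fin 2) K) - C (c j) * X (j, 1), X (j, 0) ^ (d - 1),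
        X (j, 1) ^ (d - 1)}) := by
  rw [joinPointIdeal, blockJoin, Ideal.span_iUnion]
  refine iSup_congr fun j => ?_
  rw [pointIdeal_eq_span_three, Ideal.map_span]
  congr 1
  ext g
  simp only [Set.image_insert_eq, Set.image_singleton, map_sub, map_mul, map_pow, rename_X, rename_C,
    pointForm]

/-- It is Artinian Gorenstein of socle `m(d−2) = (d−2)(n/2+1)` (`d ≥ 2`; "`J^{F,λ}` is Artinian Gorenstein of
`soc = (d−2)(n/2+1)`", Def. 2.2). [cite: DuqueFrancoVillaflor2025Join, Definition 2.2 and Remark 7.1] -/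
theorem isArtinianGorenstein_joinPointIdeal (hd : 2 ≤ d) (c : Fin m → K) :
    IsArtinianGorenstein (joinPointIdeal d c) (m * (d - 2)) := by
  have h := isArtinianGorenstein_blockJoin fun j => isArtinianGorenstein_pointIdeal hd (c j)
  rwa [Finset.sum_const, Finset.card_univ, Fintype.card_fin, smul_eq_mul] at h

/-- **Its Hilbert function is that of a linear cycle**, `φ^{*m} = ciHilbert [(d−1)^m]` (the Hilbert function of
`K[y_0,…,y_{m−1}]/(y_j^{d−1})`), INDEPENDENTLY of `c` (Cor. 6.1 iterated + Ex. 6.1: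
"`HF_{[ℙ^{n/2}]} = φ^{*(n/2+1)}`"; Rem. 7.1: "which in turn implies that `HF_λ = HF_{[ℙ^{n/2}]}`").
[cite: DuqueFrancoVillaflor2025Join, Corollary 6.1, Example 6.1 and Remark 7.1] -/
theorem hilbert_joinPointIdeal (hd : 2 ≤ d) (c : Fin m → K) (k : ℕ) :
    finrank K (homogeneousSubmodule (Fin m × Fin 2) K k) - finrank K (idealDegree (joinPointIdeal d c) k) =
      ciHilbert (List.replicate m (d - 1)) k := by
  rw [joinPointIdeal, hilbert_blockJoin_const (fun j => isArtinianGorenstein_pointIdeal hd (c j))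
    (hf := pointHF d) (fun j t => hilbert_pointIdeal hd (c j) t) k, ← linearCycleHF, linearCycleHF_eq_ciHilbert]

/-! ## The colon ideal of a join of `m` point-type classes (Thm. 1.1 iterated + Thm. 7.1) -/

section Colon

variable {F : Fin m → MvPolynomial (Fin 2) K}

/-- **The Gorenstein ideal of `δ = J(δ₀, …, δ_{m−1})`, `P_δ = ∏_j P_j(x_{(j,·)})`.** For binary forms `F_j` of
degree `d ≥ 2` with Artinian Gorenstein Jacobian ideals, points `c_j` at which the partials of `F_j` do not both
vanish, and forms `P_j ≠ 0` of degree `d − 2` with `P_j·(x − c_jy) ∈ J^{F_j}` (classes `δ_j` with the Hilbert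
function of a point, genuine or fake):
`(J^F : ∏_j P_j(x_{(j,·)})) = Σ_j ⟨x_{(j,0)} − c_jx_{(j,1)}, x_{(j,1)}^{d−1}⟩·S` — eq. (eqAGfakelcFermat).
[cite: DuqueFrancoVillaflor2025Join, Theorem 1.1, Theorem 7.1 and Remark 7.1] -/
theorem blockSumJacobian_colon_eq_joinPointIdeal (hd : 2 ≤ d) (hF : ∀ j, (F j).IsHomogeneous d)
    (hJ : ∀ j, IsArtinianGorenstein (jacobianIdeal (F j)) (2 * (d - 2))) {c : Fin m → K}
    (hc : ∀ j, eval ![c j, 1] (pderiv 0 (F j)) ≠ 0 ∨ eval ![c j, 1] (pderiv 1 (F j)) ≠ 0)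
    {P : Fin m → MvPolynomial (Fin 2) K} (hPh : ∀ j, (P j).IsHomogeneous (d - 2)) (hP0 : ∀ j, P j ≠ 0)
    (hP : ∀ j, P j * pointForm (c j) ∈ jacobianIdeal (F j)) :
    (blockSumJacobian F).colon {∏ j, rename (R := K) (Prod.mk j) (P j)} = joinPointIdeal d c := by
  rw [blockSumJacobian_eq_blockJoin, colon_blockJoin hJ, joinPointIdeal]
  congr 1
  funext j
  exact jacobianIdeal_colon_eq_pointIdeal hd (hF j) (hJ j) (hc j) (hPh j) (hP0 j) (hP j)

/-- **Cor. 6.1 iterated: the Hilbert function of `(J^F : ∏_j P_j)` is `ciHilbert [(d−1)^m]`**, that of a linear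
cycle `J(p⁰, …, p^{m−1})` — the same for all `c` ("`HF_δ = HF_{[ℙ^{n/2}]}`").
[cite: DuqueFrancoVillaflor2025Join, Corollary 6.1 and Theorem 1.5 (proof; = Theorem 1.1 of arXiv v4)] -/
theorem hilbert_blockSumJacobian_colon (hd : 2 ≤ d) (hF : ∀ j, (F j).IsHomogeneous d)
    (hJ : ∀ j, IsArtinianGorenstein (jacobianIdeal (F j)) (2 * (d - 2))) {c : Fin m → K}
    (hc : ∀ j, eval ![c j, 1] (pderiv 0 (F j)) ≠ 0 ∨ eval ![c j, 1] (pderiv 1 (F j)) ≠ 0)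
    {P : Fin m → MvPolynomial (Fin 2) K} (hPh : ∀ j, (P j).IsHomogeneous (d - 2)) (hP0 : ∀ j, P j ≠ 0)
    (hP : ∀ j, P j * pointForm (c j) ∈ jacobianIdeal (F j)) (k : ℕ) :
    finrank K (homogeneousSubmodule (Fin m × Fin 2) K k) -
        finrank K (idealDegree ((blockSumJacobian F).colon {∏ j, rename (R := K) (Prod.mk j) (P j)}) k) =
      ciHilbert (List.replicate m (d - 1)) k := by
  rw [blockSumJacobian_colon_eq_joinPointIdeal hd hF hJ hc hPh hP0 hP, hilbert_joinPointIdeal hd]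

end Colon

/-! ## Fakeness: different point tuples give different Gorenstein ideals -/

/-- Projection onto the `j`-th block: `x_{(j,i)} ↦ x_i`, `x_{(j',i)} ↦ 0` for `j' ≠ j`. [folklore] -/
private def projBlock (j : Fin m) : MvPolynomial (Fin m × Fin 2) K →ₐ[K] MvPolynomial (Fin 2) K :=
  aeval fun z => if z.1 = j then X z.2 else 0

/-- The projection onto the `j`-th block is a retraction of the `j`-th inclusion. [folklore] -/
private theorem projBlock_comp_rename_self (j : Fin m) :
    (projBlock (K := K) j).comp (rename (Prod.mk j)) = AlgHom.id K _ := by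
  refine MvPolynomial.algHom_ext fun i => ?_
  simp [projBlock]

/-- A point ideal (`d ≥ 2`) in another block dies under the projection. [folklore] -/
private theorem map_projBlock_comp_rename_of_ne (hd : 2 ≤ d) {j j' : Fin m} (h : j' ≠ j) (c : K) :
    (pointIdeal d c).map ((projBlock (K := K) j).comp (rename (Prod.mk j'))) = ⊥ := by
  rw [pointIdeal, Ideal.map_span, Ideal.span_eq_bot]
  rintro _ ⟨_, ⟨i, rfl⟩, rfl⟩
  match i with
  | 0 => simp [pointIdealGens, pointForm, projBlock, h]
  | 1 =>
    have : d - 1 ≠ 0 := by omega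
    simp [pointIdealGens, projBlock, h, this]

/-- Projection of the join of point ideals to the `j`-th block is the `j`-th point ideal. [folklore] -/
private theorem map_projBlock_joinPointIdeal (hd : 2 ≤ d) (c : Fin m → K) (j : Fin m) :
    (joinPointIdeal d c).map (projBlock (K := K) j) = pointIdeal d (c j) := by
  rw [joinPointIdeal, blockJoin, Ideal.map_iSup]
  apply le_antisymm
  · refine iSup_le fun j' => ?_
    rw [Ideal.map_mapₐ]
    by_cases h : j' = j
    · subst h
      rw [projBlock_comp_rename_self, Ideal.map_idₐ]
    · rw [map_projBlock_comp_rename_of_ne hd h]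
      exact bot_le
  · refine le_iSup_of_le j ?_
    rw [Ideal.map_mapₐ, projBlock_comp_rename_self, Ideal.map_idₐ]

/-- **`c ↦ Σ_j ⟨x_{(j,0)} − c_jx_{(j,1)}, x_{(j,1)}^{d−1}⟩S` is injective for `d ≥ 3`**: the Gorenstein ideals of
(fake or genuine) linear-cycle classes attached to different point tuples differ (Rem. 2.1: equal `J^{F,λ}` iff
proportional classes). [cite: DuqueFrancoVillaflor2025Join, Remark 2.1 and Definition 7.1] -/
theorem joinPointIdeal_injective (hd : 3 ≤ d) : Function.Injective (joinPointIdeal (K := K) (m := m) d) := by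
  intro c c' h
  funext j
  apply pointIdeal_injective hd
  rw [← map_projBlock_joinPointIdeal (by omega) c j, ← map_projBlock_joinPointIdeal (by omega) c' j, h]

/-- `(I : a·P) = (I : P)` for a non-zero scalar `a`. [folklore] -/
private theorem colon_singleton_smul_of_ne_zero {σ : Type*} (I : Ideal (MvPolynomial σ K)) {a : K} (ha : a ≠ 0)
    (P : MvPolynomial σ K) : I.colon {a • P} = I.colon {P} := by
  ext g
  rw [Submodule.mem_colon_singleton, Submodule.mem_colon_singleton, smul_eq_mul, smul_eq_mul,
    smul_eq_C_mul, mul_left_comm]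
  exact Ideal.unit_mul_mem_iff_mem I ((isUnit_iff_ne_zero.mpr ha).map C)

section Fake

variable {F : Fin m → MvPolynomial (Fin 2) K}

/-- **Fakeness for iterated joins (Def. 7.1 at the level of polynomials).** For `d ≥ 3`, the joins
`∏_j P_j(x_{(j,·)})` and `∏_j P'_j(x_{(j,·)})` of point-type classes attached to point tuples `c ≠ c'` are never
proportional: their Gorenstein ideals differ. [cite: DuqueFrancoVillaflor2025Join, Definition 7.1 and Theorem 1.5 (proof; = Theorem 1.1 of arXiv v4)] -/
theorem ne_smul_of_prod (hd : 3 ≤ d) (hF : ∀ j, (F j).IsHomogeneous d)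
    (hJ : ∀ j, IsArtinianGorenstein (jacobianIdeal (F j)) (2 * (d - 2))) {c c' : Fin m → K} (hne : c ≠ c')
    (hc : ∀ j, eval ![c j, 1] (pderiv 0 (F j)) ≠ 0 ∨ eval ![c j, 1] (pderiv 1 (F j)) ≠ 0)
    (hc' : ∀ j, eval ![c' j, 1] (pderiv 0 (F j)) ≠ 0 ∨ eval ![c' j, 1] (pderiv 1 (F j)) ≠ 0)
    {P P' : Fin m → MvPolynomial (Fin 2) K}
    (hPh : ∀ j, (P j).IsHomogeneous (d - 2)) (hP0 : ∀ j, P j ≠ 0)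
    (hP : ∀ j, P j * pointForm (c j) ∈ jacobianIdeal (F j))
    (hP'h : ∀ j, (P' j).IsHomogeneous (d - 2)) (hP'0 : ∀ j, P' j ≠ 0)
    (hP' : ∀ j, P' j * pointForm (c' j) ∈ jacobianIdeal (F j)) (μ : K) :
    ∏ j, rename (R := K) (Prod.mk j) (P j) ≠ μ • ∏ j, rename (R := K) (Prod.mk j) (P' j) := by
  have hd2 : 2 ≤ d := by omega
  intro h
  have hμ : μ ≠ 0 := by
    rintro rfl
    rw [zero_smul, Finset.prod_eq_zero_iff] at h
    obtain ⟨j, -, hj⟩ := h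
    exact hP0 j ((rename_injective _ (Prod.mk_right_injective j)).eq_iff' (map_zero _) |>.mp hj)
  have h1 := blockSumJacobian_colon_eq_joinPointIdeal hd2 hF hJ hc hPh hP0 hP
  have h2 := blockSumJacobian_colon_eq_joinPointIdeal hd2 hF hJ hc' hP'h hP'0 hP'
  rw [h, colon_singleton_smul_of_ne_zero _ hμ, h2] at h1
  exact hne (joinPointIdeal_injective hd h1.symm)

end Fake

/-! ## The theorem on the printed hypersurfaces `{Σ_j ∏_i (x_{2j} − r_{j,i} x_{2j+1}) = 0}` -/

section Split

/-- **`X = {Σ_j ∏_i (x_{(j,0)} − r_{j,i} x_{(j,1)}) = 0}` is smooth** when each `F_j = ∏_i(x − r_{j,i}y)` has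
simple roots (`r_j` injective) and `d ≠ 0` in `K`: `J^F` is Artinian Gorenstein of socle `m·2(d−2)`.
[cite: DuqueFrancoVillaflor2025Join, Theorem 1.5 (proof; = Theorem 1.1 of arXiv v4) and Theorem 7.2] -/
theorem isArtinianGorenstein_blockSumJacobian_splitForm {r : Fin m → Fin d → K}
    (hr : ∀ j, Function.Injective (r j)) (hd : 2 ≤ d) (hdK : (d : K) ≠ 0) :
    IsArtinianGorenstein (blockSumJacobian fun j => splitForm (r j)) (m * (2 * (d - 2))) :=
  isArtinianGorenstein_blockSumJacobian fun j => isArtinianGorenstein_jacobianIdeal_splitForm (hr j) hd hdK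

/-- **The point-type classes exist in every block**: for every tuple `c`, there are forms `P_j ≠ 0` of degree
`d − 2` with `P_j·(x − c_jy) ∈ J^{F_j}` — DFV's `P` of Thm. 7.1 (eq. (eqPfake0dim)) when `c_j` is not a root of
`F_j`, the point polynomial `P_i` of eq. (eqPi) when it is.
[cite: DuqueFrancoVillaflor2025Join, Theorem 7.1, eq. (eqPfake0dim) and eq. (eqPi)] -/
theorem exists_blockPolynomials_splitForm {r : Fin m → Fin d → K} (hr : ∀ j, Function.Injective (r j))
    (hd : 2 ≤ d) (hdK : (d : K) ≠ 0) (c : Fin m → K) :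
    ∃ P : Fin m → MvPolynomial (Fin 2) K, (∀ j, (P j).IsHomogeneous (d - 2)) ∧ (∀ j, P j ≠ 0) ∧
      ∀ j, P j * pointForm (c j) ∈ jacobianIdeal (splitForm (r j)) := by
  have h : ∀ j, ∃ P : MvPolynomial (Fin 2) K, P.IsHomogeneous (d - 2) ∧ P ≠ 0 ∧
      P * pointForm (c j) ∈ jacobianIdeal (splitForm (r j)) := by
    intro j
    by_cases hc : ∃ i, c j = r j i
    · obtain ⟨i, hi⟩ := hc
      obtain ⟨Q, hQh, hQ0, -, hQ⟩ := exists_pointPolynomial_splitForm (hr j) hd i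
      exact ⟨Q, hQh, hQ0, by rw [hi]; exact hQ⟩
    · push Not at hc
      obtain ⟨P, hPh, hP0, -, hP⟩ := exists_dfvPolynomial_splitForm (hr j) hd hdK hc
      exact ⟨P, hPh, hP0, hP⟩
  choose P hP using h
  exact ⟨P, fun j => (hP j).1, fun j => (hP j).2.1, fun j => (hP j).2.2⟩

/-- **Duque Franco–Villaflor, Thm. 1.5 of arXiv v1–v3 = Thm. 1.1 of arXiv v4 (algebraic core), EVERY even `n`:
the hypersurfaces `X = {Σ_{j<m} ∏_{i<d} (x_{(j,0)} − r_{j,i}x_{(j,1)}) = 0} ⊂ ℙ^{2m−1}` carry fake linear cycles,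
in every degree `d ≥ 3`.** Let each `r_j` be injective (simple roots), `d ≥ 3`, `d ≠ 0` in `K`; let
`c : Fin m → K` be a tuple of points NOT all of which are roots (`c_j ∉ {r_{j,i}}` for some `j` — that `δ_j` is a
`0`-dimensional fake linear cycle, Thm. 7.1), and `P_j ≠ 0` forms of degree `d − 2` with `P_j·(x − c_jy) ∈ J^{F_j}`
(they exist: `exists_blockPolynomials_splitForm`). Then for the join `P = ∏_j P_j(x_{(j,·)})` (`= P_{J(δ₀,…,δ_{m−1})}`
by Thm. 1.1) and EVERY genuine linear cycle `J(p⁰_{i₀}, …, p^{m−1}_{i_{m−1}}) = {x_{(j,0)} = r_{j,i_j}x_{(j,1)}}`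
(polynomial `∏_j Q_j(x_{(j,·)})`, `Q_j·(x − r_{j,i_j}y) ∈ J^{F_j}`, `Q_j ≠ 0`): (i)
`(J^F : P) = ⟨x_{(j,0)} − c_jx_{(j,1)}, x_{(j,0)}^{d−1}, x_{(j,1)}^{d−1} : j⟩` (eq. (eqAGfakelcFermat)); (ii) `(J^F : P)`
and `(J^F : ∏Q_j)` have the same Hilbert function (`ciHilbert [(d−1)^m]`, that of a linear cycle:
"`HF_δ = HF_{[ℙ^{n/2}]}`"); (iii) `P` is not a scalar multiple of `∏_j Q_j` ("`λ_prim ∉ K·[Z]_prim`"). So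
`δ = J(δ₀, …, δ_{m−1})` is a fake version of every linear cycle class — a fake linear cycle. In print `K = ℚ`
(rationality of `δ` from `P_j, Q_j ∈ ℚ[x,y]`); the dictionary `(J^F : P_λ) = J^{F,λ}`, `P_{J(Z₁,Z₂)} = P_{Z₁}P_{Z₂}`
(residues) is cited, not formalised. [cite: DuqueFrancoVillaflor2025Join, Theorem 1.5 (proof, p. 19; = Theorem 1.1 of arXiv v4) and Definition 7.1] -/
theorem splitHypersurface_fake_linear_cycle {r : Fin m → Fin d → K} (hr : ∀ j, Function.Injective (r j))
    (hd : 3 ≤ d) (hdK : (d : K) ≠ 0) {c : Fin m → K} (hc : ∃ j, ∀ i, c j ≠ r j i)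
    {P : Fin m → MvPolynomial (Fin 2) K} (hPh : ∀ j, (P j).IsHomogeneous (d - 2)) (hP0 : ∀ j, P j ≠ 0)
    (hP : ∀ j, P j * pointForm (c j) ∈ jacobianIdeal (splitForm (r j))) (i : Fin m → Fin d)
    {Q : Fin m → MvPolynomial (Fin 2) K} (hQh : ∀ j, (Q j).IsHomogeneous (d - 2)) (hQ0 : ∀ j, Q j ≠ 0)
    (hQ : ∀ j, Q j * pointForm (r j (i j)) ∈ jacobianIdeal (splitForm (r j))) :
    (blockSumJacobian fun j => splitForm (r j)).colon {∏ j, rename (R := K) (Prod.mk j) (P j)} =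
        Ideal.span (⋃ j : Fin m, {(X (j, 0) : MvPolynomial (Fin m × Fin 2) K) - C (c j) * X (j, 1),
          X (j, 0) ^ (d - 1), X (j, 1) ^ (d - 1)}) ∧
      (∀ k, finrank K (homogeneousSubmodule (Fin m × Fin 2) K k) -
          finrank K (idealDegree ((blockSumJacobian fun j => splitForm (r j)).colon
            {∏ j, rename (R := K) (Prod.mk j) (P j)}) k) =
        finrank K (homogeneousSubmodule (Fin m × Fin 2) K k) -
          finrank K (idealDegree ((blockSumJacobian fun j => splitForm (r j)).colon
            {∏ j, rename (R := K) (Prod.mk j) (Q j)}) k)) ∧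
      ∀ μ : K, ∏ j, rename (R := K) (Prod.mk j) (P j) ≠ μ • ∏ j, rename (R := K) (Prod.mk j) (Q j) := by
  have hd2 : 2 ≤ d := by omega
  have hF : ∀ j, (splitForm (r j)).IsHomogeneous d := fun j => isHomogeneous_splitForm (r j)
  have hJ : ∀ j, IsArtinianGorenstein (jacobianIdeal (splitForm (r j))) (2 * (d - 2)) := fun j =>
    isArtinianGorenstein_jacobianIdeal_splitForm (hr j) hd2 hdK
  have hc' : ∀ j, eval ![c j, 1] (pderiv 0 (splitForm (r j))) ≠ 0 ∨
      eval ![c j, 1] (pderiv 1 (splitForm (r j))) ≠ 0 := fun j => eval_pderiv_splitForm_ne_zero (hr j) hdK (c j)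
  have hr' : ∀ j, eval ![r j (i j), 1] (pderiv 0 (splitForm (r j))) ≠ 0 ∨
      eval ![r j (i j), 1] (pderiv 1 (splitForm (r j))) ≠ 0 := fun j =>
    eval_pderiv_splitForm_ne_zero (hr j) hdK (r j (i j))
  have hne : c ≠ fun j => r j (i j) := by
    obtain ⟨j, hj⟩ := hc
    intro h
    exact hj (i j) (congrFun h j)
  refine ⟨?_, fun k => ?_, fun μ => ?_⟩
  · rw [blockSumJacobian_colon_eq_joinPointIdeal hd2 hF hJ hc' hPh hP0 hP, joinPointIdeal_eq_span]
  · rw [hilbert_blockSumJacobian_colon hd2 hF hJ hc' hPh hP0 hP k,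
      hilbert_blockSumJacobian_colon hd2 hF hJ hr' hQh hQ0 hQ k]
  · exact ne_smul_of_prod hd hF hJ hne hc' hr' hPh hP0 hP hQh hQ0 hQ μ


/-- **"… containing infinitely many fake linear cycles"** (Thm. 1.5 / Thm. 1.1 of arXiv v4), at the level of
Gorenstein ideals: over an INFINITE field `K`, on each `X = {Σ_{j<m} ∏_i (x_{(j,0)} − r_{j,i}x_{(j,1)}) = 0}`
(`m ≥ 1` blocks with simple roots, `d ≥ 3`, `d ≠ 0` in `K`) the ideals `J^{F,δ} = (J^F : ∏_j P_j)` of the fake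
classes `δ = J(δ₀, …, δ_{m−1})` (point tuples `c` with some `c_j` not a root, point-type `P_j`) form an infinite
set — distinct `J^{F,δ}` means pairwise non-proportional classes (Rem. 2.1). Witnesses: the constant tuples
`c ≡ t`, `t ∉ {r_{0,i}}`. [cite: DuqueFrancoVillaflor2025Join, Theorem 1.5 (= Theorem 1.1 of arXiv v4) and Remark 2.1] -/
theorem infinite_fake_colon_ideals [Infinite K] {r : Fin m → Fin d → K} (hr : ∀ j, Function.Injective (r j))
    (hd : 3 ≤ d) (hdK : (d : K) ≠ 0) (hm : 0 < m) :
    Set.Infinite {I : Ideal (MvPolynomial (Fin m × Fin 2) K) |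
      ∃ (c : Fin m → K) (P : Fin m → MvPolynomial (Fin 2) K), (∃ j, ∀ i, c j ≠ r j i) ∧
        (∀ j, (P j).IsHomogeneous (d - 2)) ∧ (∀ j, P j ≠ 0) ∧
        (∀ j, P j * pointForm (c j) ∈ jacobianIdeal (splitForm (r j))) ∧
        I = (blockSumJacobian fun j => splitForm (r j)).colon {∏ j, rename (R := K) (Prod.mk j) (P j)}} := by
  have hd2 : 2 ≤ d := by omega
  set j₀ : Fin m := ⟨0, hm⟩ with hj₀
  have hF : ∀ j, (splitForm (r j)).IsHomogeneous d := fun j => isHomogeneous_splitForm (r j)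
  have hJ : ∀ j, IsArtinianGorenstein (jacobianIdeal (splitForm (r j))) (2 * (d - 2)) := fun j =>
    isArtinianGorenstein_jacobianIdeal_splitForm (hr j) hd2 hdK
  -- the constant tuples `c ≡ t` with `t` not a root of `F_{j₀}`: infinitely many, with distinct ideals
  refine Set.infinite_of_injOn_mapsTo (s := (Set.range (r j₀))ᶜ)
    (f := fun t : K => joinPointIdeal (m := m) d fun _ => t) (fun t _ t' _ h => ?_) (fun t ht => ?_)
    ((Set.finite_range (r j₀)).infinite_compl)
  · exact congrFun (joinPointIdeal_injective hd h) j₀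
  · have ht' : ∀ i, t ≠ r j₀ i := fun i h => ht ⟨i, h.symm⟩
    obtain ⟨P, hPh, hP0, hP⟩ := exists_blockPolynomials_splitForm hr hd2 hdK (fun _ : Fin m => t)
    refine ⟨fun _ => t, P, ⟨j₀, ht'⟩, hPh, hP0, hP, ?_⟩
    exact (blockSumJacobian_colon_eq_joinPointIdeal hd2 hF hJ
      (fun j => eval_pderiv_splitForm_ne_zero (hr j) hdK t) hPh hP0 hP).symm

end Split

end BlockSum

/-! ## In the printed coordinates `x_0, …, x_{n+1}` of `ℙ^{n+1}` (`x_{2j+i} ↔ x_{(j,i)}`, `n = 2k`) -/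

section Printed

variable {k d : ℕ}

/-- The relabeling `x_{(j,i)} ↦ x_{2j+i}` of the `2k+2` coordinates of `ℙ^{n+1}`, `n = 2k`. [folklore] -/
def pairIndexEquiv (k : ℕ) : Fin (k + 1) × Fin 2 ≃ Fin (2 * k + 1 + 1) :=
  finProdFinEquiv.trans (finCongr (by ring))

/-- `x_{(j,i)} ↦ x_{2j+i}`: the `i`-th variable of the `j`-th block is the printed `x_{2j+i}`
("`X_i := {F_i(x_{2i},x_{2i+1}) = 0}`"). [cite: DuqueFrancoVillaflor2025Join, Theorem 1.5 (proof; = Theorem 1.1 of arXiv v4)] -/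
@[simp] theorem pairIndexEquiv_apply_val (j : Fin (k + 1)) (i : Fin 2) :
    ((pairIndexEquiv k (j, i) : Fin (2 * k + 1 + 1)) : ℕ) = 2 * j + i := by
  simp [pairIndexEquiv]
  ring

/-- **DFV's `F = F_0(x_0,x_1) + F_1(x_2,x_3) + ⋯ + F_{n/2}(x_n,x_{n+1}) ∈ K[x_0, …, x_{n+1}]`**, `n = 2k`.
[cite: DuqueFrancoVillaflor2025Join, Theorem 1.5 (proof, p. 19; = Theorem 1.1 of arXiv v4) and Theorem 7.2] -/
def splitSumForm (F : Fin (k + 1) → MvPolynomial (Fin 2) K) : MvPolynomial (Fin (2 * k + 1 + 1)) K :=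
  rename (pairIndexEquiv k) (blockSum F)

/-- `F = Σ_j F_j(x_{2j}, x_{2j+1})`. [cite: DuqueFrancoVillaflor2025Join, Theorem 1.5 (proof; = Theorem 1.1 of arXiv v4)] -/
theorem splitSumForm_eq_sum (F : Fin (k + 1) → MvPolynomial (Fin 2) K) :
    splitSumForm F = ∑ j, rename (fun i : Fin 2 => pairIndexEquiv k (j, i)) (F j) := by
  rw [splitSumForm, blockSum, map_sum]
  refine Finset.sum_congr rfl fun j _ => ?_
  rw [rename_rename]
  rfl

/-- `F` is a form of degree `d` when the `F_j ∈ K[x,y]_d` are. [cite: DuqueFrancoVillaflor2025Join, Theorem 1.5 (proof; = Theorem 1.1 of arXiv v4)] -/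
theorem isHomogeneous_splitSumForm {F : Fin (k + 1) → MvPolynomial (Fin 2) K}
    (hF : ∀ j, (F j).IsHomogeneous d) : (splitSumForm F).IsHomogeneous d :=
  (isHomogeneous_blockSum hF).rename_isHomogeneous

/-- **`J^F` (tree `jacobianIdeal`) is the relabelled `Σ_j J^{F_j}S`.** [cite: DuqueFrancoVillaflor2025Join, Theorem 1.1 (proof) and Remark 7.1] -/
theorem jacobianIdeal_splitSumForm (F : Fin (k + 1) → MvPolynomial (Fin 2) K) :
    jacobianIdeal (splitSumForm F) = (blockSumJacobian F).map
      (rename (pairIndexEquiv k) : MvPolynomial (Fin (k + 1) × Fin 2) K →ₐ[K] MvPolynomial (Fin (2 * k + 1 + 1)) K) := by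
  rw [jacobianIdeal, blockSumJacobian, Ideal.map_span, splitSumForm]
  congr 1
  ext g
  simp only [Set.mem_range, Set.mem_image, exists_exists_eq_and]
  constructor
  · rintro ⟨l, rfl⟩
    refine ⟨(pairIndexEquiv k).symm l, ?_⟩
    conv_rhs => rw [← (pairIndexEquiv k).apply_symm_apply l]
    rw [pderiv_rename (pairIndexEquiv k).injective]
  · rintro ⟨z, rfl⟩
    exact ⟨pairIndexEquiv k z, by rw [pderiv_rename (pairIndexEquiv k).injective]⟩

/-- `∏_j P_j(x_{2j}, x_{2j+1})` is the relabelled `∏_j P_j(x_{(j,·)})`. [folklore] -/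
private theorem prod_rename_pairIndexEquiv (P : Fin (k + 1) → MvPolynomial (Fin 2) K) :
    ∏ j, rename (R := K) (fun i : Fin 2 => pairIndexEquiv k (j, i)) (P j) =
      rename (pairIndexEquiv k) (∏ j, rename (R := K) (Prod.mk j) (P j)) := by
  rw [map_prod]
  refine Finset.prod_congr rfl fun j _ => ?_
  rw [rename_rename]
  rfl

variable {F : Fin (k + 1) → MvPolynomial (Fin 2) K}

/-- **`X = {F = 0} ⊂ ℙ^{n+1}` is smooth when the `X_j ⊂ ℙ¹` are**: `J^F` is Artinian Gorenstein of socle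
`(n/2+1)·2(d−2) = (d−2)(n+2)`. [cite: DuqueFrancoVillaflor2025Join, Theorem 1.1 (proof) and Definition 2.2] -/
theorem isArtinianGorenstein_jacobianIdeal_splitSumForm
    (hJ : ∀ j, IsArtinianGorenstein (jacobianIdeal (F j)) (2 * (d - 2))) :
    IsArtinianGorenstein (jacobianIdeal (splitSumForm F)) ((k + 1) * (2 * (d - 2))) := by
  rw [jacobianIdeal_splitSumForm]
  exact (isArtinianGorenstein_blockSumJacobian hJ).map_rename_equiv _

/-- **eq. (eqAGfakelcFermat) on `X`**: `J^{F,δ} = (J^F : ∏_j P_j(x_{2j},x_{2j+1}))`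
`= ⟨x_{2j} − c_jx_{2j+1}, x_{2j}^{d−1}, x_{2j+1}^{d−1} : j ≤ n/2⟩` for point-type classes `δ_j` (genuine or fake)
at the points `c_j`. [cite: DuqueFrancoVillaflor2025Join, Theorem 1.1, Theorem 7.1 and Remark 7.1, eq. (eqAGfakelcFermat)] -/
theorem jacobianIdeal_splitSumForm_colon_eq_span (hd : 2 ≤ d) (hF : ∀ j, (F j).IsHomogeneous d)
    (hJ : ∀ j, IsArtinianGorenstein (jacobianIdeal (F j)) (2 * (d - 2))) {c : Fin (k + 1) → K}
    (hc : ∀ j, eval ![c j, 1] (pderiv 0 (F j)) ≠ 0 ∨ eval ![c j, 1] (pderiv 1 (F j)) ≠ 0)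
    {P : Fin (k + 1) → MvPolynomial (Fin 2) K} (hPh : ∀ j, (P j).IsHomogeneous (d - 2)) (hP0 : ∀ j, P j ≠ 0)
    (hP : ∀ j, P j * pointForm (c j) ∈ jacobianIdeal (F j)) :
    (jacobianIdeal (splitSumForm F)).colon {∏ j, rename (R := K) (fun i : Fin 2 => pairIndexEquiv k (j, i)) (P j)} =
      Ideal.span (⋃ j : Fin (k + 1), {(X (pairIndexEquiv k (j, 0)) : MvPolynomial (Fin (2 * k + 1 + 1)) K) -
        C (c j) * X (pairIndexEquiv k (j, 1)), X (pairIndexEquiv k (j, 0)) ^ (d - 1),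
          X (pairIndexEquiv k (j, 1)) ^ (d - 1)}) := by
  rw [jacobianIdeal_splitSumForm, prod_rename_pairIndexEquiv, colon_map_rename_equiv,
    blockSumJacobian_colon_eq_joinPointIdeal hd hF hJ hc hPh hP0 hP, joinPointIdeal_eq_span, Ideal.map_span,
    Set.image_iUnion]
  congr 1
  refine Set.iUnion_congr fun j => ?_
  simp only [Set.image_insert_eq, Set.image_singleton, map_sub, map_mul, map_pow, rename_X, rename_C]

/-- **"`HF_δ = HF_{[ℙ^{n/2}]}`" on `X`**: the Hilbert function of `(J^F : ∏_j P_j(x_{2j},x_{2j+1}))` is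
`ciHilbert [(d−1)^{n/2+1}]`, whatever the points `c_j`. [cite: DuqueFrancoVillaflor2025Join, Corollary 6.1, Example 6.1 and Remark 7.1] -/
theorem hilbert_jacobianIdeal_splitSumForm_colon (hd : 2 ≤ d) (hF : ∀ j, (F j).IsHomogeneous d)
    (hJ : ∀ j, IsArtinianGorenstein (jacobianIdeal (F j)) (2 * (d - 2))) {c : Fin (k + 1) → K}
    (hc : ∀ j, eval ![c j, 1] (pderiv 0 (F j)) ≠ 0 ∨ eval ![c j, 1] (pderiv 1 (F j)) ≠ 0)
    {P : Fin (k + 1) → MvPolynomial (Fin 2) K} (hPh : ∀ j, (P j).IsHomogeneous (d - 2)) (hP0 : ∀ j, P j ≠ 0)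
    (hP : ∀ j, P j * pointForm (c j) ∈ jacobianIdeal (F j)) (t : ℕ) :
    finrank K (homogeneousSubmodule (Fin (2 * k + 1 + 1)) K t) -
        finrank K (idealDegree ((jacobianIdeal (splitSumForm F)).colon
          {∏ j, rename (R := K) (fun i : Fin 2 => pairIndexEquiv k (j, i)) (P j)}) t) =
      ciHilbert (List.replicate (k + 1) (d - 1)) t := by
  rw [jacobianIdeal_splitSumForm, prod_rename_pairIndexEquiv, colon_map_rename_equiv, hilbert_map_rename_equiv,
    hilbert_blockSumJacobian_colon hd hF hJ hc hPh hP0 hP]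

/-- **Duque Franco–Villaflor, Thm. 1.5 of arXiv v1–v3 = Thm. 1.1 of arXiv v4 (algebraic core) in the coordinates
of `ℙ^{n+1}`, `n = 2k`, every `k` and every `d ≥ 3`.** For `X = {Σ_{j ≤ k} ∏_{i<d}(x_{2j} − r_{j,i}x_{2j+1}) = 0}`
(`r_j` injective, `d ≠ 0` in `K`), a point tuple `c` not all of whose entries are roots, forms `P_j ≠ 0` of degree
`d − 2` with `P_j·(x − c_jy) ∈ J^{F_j}`, and ANY genuine linear cycle `{x_{2j} = r_{j,i_j}x_{2j+1}} ⊂ X` with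
polynomials `Q_j` (`Q_j·(x − r_{j,i_j}y) ∈ J^{F_j}`, `Q_j ≠ 0`): (i) `(J^F : ∏_j P_j(x_{2j},x_{2j+1}))`
`= ⟨x_{2j} − c_jx_{2j+1}, x_{2j}^{d−1}, x_{2j+1}^{d−1} : j ≤ k⟩`; (ii) it has the same Hilbert function as
`(J^F : ∏_j Q_j(x_{2j},x_{2j+1}))` (that of a linear `ℙ^{k}`); (iii) `∏_j P_j` is not a scalar multiple of `∏_j Q_j` —
`δ = J(δ_0, …, δ_k)` is a fake linear cycle on the smooth hypersurface `X ⊂ ℙ^{2k+1}` of degree `d`.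
[cite: DuqueFrancoVillaflor2025Join, Theorem 1.5 (proof, p. 19; = Theorem 1.1 of arXiv v4) and Definition 7.1] -/
theorem splitHypersurface_fake_linear_cycle' {r : Fin (k + 1) → Fin d → K} (hr : ∀ j, Function.Injective (r j))
    (hd : 3 ≤ d) (hdK : (d : K) ≠ 0) {c : Fin (k + 1) → K} (hc : ∃ j, ∀ i, c j ≠ r j i)
    {P : Fin (k + 1) → MvPolynomial (Fin 2) K} (hPh : ∀ j, (P j).IsHomogeneous (d - 2)) (hP0 : ∀ j, P j ≠ 0)
    (hP : ∀ j, P j * pointForm (c j) ∈ jacobianIdeal (splitForm (r j))) (i : Fin (k + 1) → Fin d)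
    {Q : Fin (k + 1) → MvPolynomial (Fin 2) K} (hQh : ∀ j, (Q j).IsHomogeneous (d - 2)) (hQ0 : ∀ j, Q j ≠ 0)
    (hQ : ∀ j, Q j * pointForm (r j (i j)) ∈ jacobianIdeal (splitForm (r j))) :
    (jacobianIdeal (splitSumForm fun j => splitForm (r j))).colon
        {∏ j, rename (R := K) (fun i : Fin 2 => pairIndexEquiv k (j, i)) (P j)} =
      Ideal.span (⋃ j : Fin (k + 1), {(X (pairIndexEquiv k (j, 0)) : MvPolynomial (Fin (2 * k + 1 + 1)) K) -
        C (c j) * X (pairIndexEquiv k (j, 1)), X (pairIndexEquiv k (j, 0)) ^ (d - 1),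
          X (pairIndexEquiv k (j, 1)) ^ (d - 1)}) ∧
      (∀ t, finrank K (homogeneousSubmodule (Fin (2 * k + 1 + 1)) K t) -
          finrank K (idealDegree ((jacobianIdeal (splitSumForm fun j => splitForm (r j))).colon
            {∏ j, rename (R := K) (fun i : Fin 2 => pairIndexEquiv k (j, i)) (P j)}) t) =
        finrank K (homogeneousSubmodule (Fin (2 * k + 1 + 1)) K t) -
          finrank K (idealDegree ((jacobianIdeal (splitSumForm fun j => splitForm (r j))).colon
            {∏ j, rename (R := K) (fun i : Fin 2 => pairIndexEquiv k (j, i)) (Q j)}) t)) ∧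
      ∀ μ : K, ∏ j, rename (R := K) (fun i : Fin 2 => pairIndexEquiv k (j, i)) (P j) ≠
        μ • ∏ j, rename (R := K) (fun i : Fin 2 => pairIndexEquiv k (j, i)) (Q j) := by
  have hd2 : 2 ≤ d := by omega
  have hF : ∀ j, (splitForm (r j)).IsHomogeneous d := fun j => isHomogeneous_splitForm (r j)
  have hJ : ∀ j, IsArtinianGorenstein (jacobianIdeal (splitForm (r j))) (2 * (d - 2)) := fun j =>
    isArtinianGorenstein_jacobianIdeal_splitForm (hr j) hd2 hdK
  have hc' : ∀ j, eval ![c j, 1] (pderiv 0 (splitForm (r j))) ≠ 0 ∨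
      eval ![c j, 1] (pderiv 1 (splitForm (r j))) ≠ 0 := fun j => eval_pderiv_splitForm_ne_zero (hr j) hdK (c j)
  have hr' : ∀ j, eval ![r j (i j), 1] (pderiv 0 (splitForm (r j))) ≠ 0 ∨
      eval ![r j (i j), 1] (pderiv 1 (splitForm (r j))) ≠ 0 := fun j =>
    eval_pderiv_splitForm_ne_zero (hr j) hdK (r j (i j))
  obtain ⟨-, -, hiii⟩ := splitHypersurface_fake_linear_cycle hr hd hdK hc hPh hP0 hP i hQh hQ0 hQ
  refine ⟨jacobianIdeal_splitSumForm_colon_eq_span hd2 hF hJ hc' hPh hP0 hP, fun t => ?_, fun μ h => ?_⟩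
  · rw [hilbert_jacobianIdeal_splitSumForm_colon hd2 hF hJ hc' hPh hP0 hP,
      hilbert_jacobianIdeal_splitSumForm_colon hd2 hF hJ hr' hQh hQ0 hQ]
  · refine hiii μ (rename_injective _ (pairIndexEquiv k).injective ?_)
    rw [← prod_rename_pairIndexEquiv, h, map_smul, prod_rename_pairIndexEquiv]

end Printed

end Literature.AlgebraicGeometry.DuqueFrancoVillaflor2025

end
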